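import Summits.Ventures.CertifiedArithmetic.LowPrec.GemmThetaLawE2M1Check01
import Summits.Ventures.CertifiedArithmetic.LowPrec.GemmThetaLawE2M1Check02
import Summits.Ventures.CertifiedArithmetic.LowPrec.GemmThetaLawE2M1Check03
import Summits.Ventures.CertifiedArithmetic.LowPrec.GemmThetaLawE2M1Check04
import Summits.Ventures.CertifiedArithmetic.LowPrec.GemmThetaLawE2M1Check05
import Summits.Ventures.CertifiedArithmetic.LowPrec.GemmThetaLawE2M1Check06
import Summits.Ventures.CertifiedArithmetic.LowPrec.GemmThetaLawE2M1Check07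
import Summits.Ventures.CertifiedArithmetic.LowPrec.GemmThetaLawE2M1Sound

/-!
# The θ-certificate of E2M1² at every precision `p ≥ 9`: the finite checks assembled

HONEST FRAMING (venture CertifiedArithmetic / cell `pub-lowprec`, seat gemm, gen 12): certified error
envelopes and provably optimal rounding/accumulation schemes for low-precision formats under stated
cost models; every table by two implementations; no hardware or vendor claims.

Assembles the seven `decide +kernel` parts `GemmThetaLawE2M1Check01…07.lean` of the symbolic
certificate `GemmThetaLawE2M1Defs.lean` (paper `gemm.tex` §Regimes Thm t:thetap (iii)) into the two
facts consumed by `GemmThetaLawE2M1Law.lawZ_of_checks`: every valid class passes `clsOK` (`cls_ok`: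
1313 magnitude classes × 37 letters × 2 signs = 97,162 symbolic edges) and every pair table of a
binade `j' ≤ 6` passes (`pair_ok`: 7 × 74 even vertices × 37 letters × 2 signs = 38,332 symbolic
pair edges).
-/

namespace Literature.ComputerArithmetic.FloatingPoint

namespace MiniFloat

namespace ThetaLawE2M1

/-- All classes `qh z`, `1 ≤ z ≤ 144`, pass. [cell certificate, kernel-checked] -/
theorem qh_all : qhOK 1 144 = true := all_range'_append 1 72 72 qh_ok_1 qh_ok_73

/-- All classes `low j t`, `j ≤ 7`, `t ≤ 71`, pass. [cell certificate, kernel-checked] -/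
theorem low_all (j : ℕ) (hj : j ≤ 7) : lowOK j 0 72 = true := by
  rcases j with _ | _ | _ | _ | _ | _ | _ | _ | j
  · exact low_ok_0
  · exact low_ok_1
  · exact low_ok_2
  · exact low_ok_3
  · exact low_ok_4
  · exact low_ok_5
  · exact low_ok_6
  · exact low_ok_7
  · omega

/-- All classes `high j s`, `j ≤ 7`, `1 ≤ s ≤ 72`, pass. [cell certificate, kernel-checked] -/
theorem high_all (j : ℕ) (hj : j ≤ 7) : highOK j 1 72 = true := by
  rcases j with _ | _ | _ | _ | _ | _ | _ | _ | j
  · exact high_ok_0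
  · exact high_ok_1
  · exact high_ok_2
  · exact high_ok_3
  · exact high_ok_4
  · exact high_ok_5
  · exact high_ok_6
  · exact high_ok_7
  · omega

/-- EVERY VALID CLASS PASSES `clsOK` (all 97,162 symbolic edges). [cell certificate, kernel-checked] -/
theorem cls_ok (c : Cls) (hc : c.valid) : clsOK c = true := by
  cases c with
  | qh z =>
    simp only [Cls.valid] at hc
    exact List.all_eq_true.mp qh_all z (List.mem_range'_1.mpr ⟨hc.1, by omega⟩)
  | low j t =>
    simp only [Cls.valid] at hc
    rcases hc with ⟨hj, ht⟩ | ⟨rfl, rfl⟩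
    · exact List.all_eq_true.mp (low_all j hj) t (List.mem_range'_1.mpr ⟨by omega, by omega⟩)
    · exact top_ok
  | mid j π =>
    simp only [Cls.valid] at hc
    have h := List.all_eq_true.mp mid_ok j (List.mem_range.mpr (by omega))
    rw [Bool.and_eq_true] at h
    rcases π with _ | _ | π
    · exact h.1
    · exact h.2
    · omega
  | high j s =>
    simp only [Cls.valid] at hc
    exact List.all_eq_true.mp (high_all j hc.1) s (List.mem_range'_1.mpr ⟨hc.2.1, by omega⟩)

/-- EVERY PAIR TABLE OF A BINADE `j' ≤ 6` PASSES (all 38,332 symbolic pair edges).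
[cell certificate, kernel-checked] -/
theorem pair_ok (jp : ℕ) (h : jp ≤ 6) : pairTableOK jp = true := by
  rcases jp with _ | _ | _ | _ | _ | _ | _ | jp
  · exact pair_ok_0
  · exact pair_ok_1
  · exact pair_ok_2
  · exact pair_ok_3
  · exact pair_ok_4
  · exact pair_ok_5
  · exact pair_ok_6
  · omega

end ThetaLawE2M1

end MiniFloat

end Literature.ComputerArithmetic.FloatingPoint
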